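import Summits.QuantumFields.YangMills.Theorems.ToronValleyVolumeLojasiewiczLocaliseQuaternion
import Literature.MathematicalPhysics.QuantumLattice.SU2HaarSmallBallUpper
import HarnessLib

/-!
# Route `VirialFluxGap` (YangMills): ONE-INSERTION FIRST VARIATIONS OF A COMMUTATOR WORD ARE LINEAR IN THE ALGEBRA COMMUTATOR — the quaternion core of the
# Euler-defect structure lemma for the central chart of ⟨stmt-QuantumFields-24141⟩ `PeriodicSoftness` (free-hands helper)

Width seat `ym-line-sfw-p2-w3` g59 (cell ym-idea-1, free hands), `--supports stmt-QuantumFields-24141`.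

At a comb-constant history every term of the ring polynomial whose first variation is non-zero is a CONJUGATE OF A GROUP COMMUTATOR `W = a·b·ā·b̄` of two
anchors (doubly-wrap plaquettes: `a = c_k, b = c_l`; wrap-link seam bonds: `a = c_k, b = c₄`), and a frame direction inserts `e^{sτ}` after ONE letter.  The
(E1) ledger of the explicit central field (HOME memo `w3-g59-EXPLICIT-CENTRAL-FIELD-24141.md`, §3 and §5 (2)) needs these first variations to be LINEAR IN THE
ALGEBRA COMMUTATOR `[a,b] = ab − ba = (0, 2·Im a × Im b)` with bounded coefficients — then the Euler defect `φ = 2(∂_w g − g)` of the first variation on the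
family is `O(|z|·Σ|z_B × z_B'|)`.  This file is the pure quaternion algebra of that statement (unit quaternions `a, b`; `τ, u` arbitrary):

* §1 `star_eq_two_re_sub'`, ★ `comm_star_left` ∕ `comm_star_right` ∕ `comm_star_star` — replacing a letter by its conjugate does not change the commutator up to
  sign: `b·ā − ā·b = ab − ba`, `ā·b̄ − b̄·ā = ab − ba`, `a·b̄ − b̄·a = −(ab − ba)`;
* §2 ★★ `groupComm_sub_one` — **`a·b·ā·b̄ − 1 = (ab − ba)·(ā·b̄)`** for unit `a, b` (and the three cyclic variants `bāb̄a`, `āb̄ab`, `b̄abā`, each `− 1 = [a,b]·(unit)`);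
* §3 ★★ `re_insertion_eq` — the one-insertion first variation `Re(τ·(W − 1))` equals `Re(τ·[a,b]·v)` with an explicit unit `v`, and ★★ `abs_re_insertion_le` —
  `|Re(τ·(W − 1))| ≤ ‖τ‖·‖ab − ba‖` for each of the four cyclic words; with ✓`normSq_comm_eq` (`‖ab − ba‖² = 4(|Im a|²|Im b|² − (Im a·Im b)²)`) this is the bound
  `|first variation| ≤ 2‖τ‖·|Im a × Im b|`.

HONEST LABEL: quaternion algebra; the lattice bookkeeping (which terms of `ringPoly` see which variable, ⧗`ConstSlicesFirstVariation`) and the Euler-defect bound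
itself are NOT here; ⟨24141⟩ and ⟨22884⟩ stay OPEN; the Yang–Mills mass gap is NOT proved by this; no summit is proved by a line.  THEOREMS ONLY (no `def`, no `sorry`).

References: [cite: CosteEtAl1985]; [cite: Luscher1983, §2].
-/

set_option autoImplicit false

noncomputable section

open scoped Quaternion

namespace Summit.QuantumFields.YangMills.Theorems.VirialFluxGap.CommutatorInsertion


/-! ## §1 Conjugate letters do not change the commutator -/

/-- `conj a = 2·Re a − a`. [folklore] -/
theorem star_eq_two_re_sub' (a : ℍ) : star a = (2 * a.re : ℝ) - a := by
  rw [Quaternion.star_eq_two_re_sub]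

/-- ★ `b·ā − ā·b = a·b − b·a`. [folklore] -/
theorem comm_star_left (a b : ℍ) : b * star a - star a * b = a * b - b * a := by
  rw [star_eq_two_re_sub']
  simp only [mul_sub, sub_mul, Quaternion.coe_mul_eq_smul, Quaternion.mul_coe_eq_smul]
  abel

/-- ★ `ā·b̄ − b̄·ā = a·b − b·a`. [folklore] -/
theorem comm_star_star (a b : ℍ) : star a * star b - star b * star a = a * b - b * a := by
  rw [← star_mul, ← star_mul, ← star_sub, star_eq_two_re_sub']
  have hre : (b * a - a * b).re = 0 := by simp [Quaternion.re_mul]; ring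
  rw [hre]
  simp

/-- ★ `a·b̄ − b̄·a = −(a·b − b·a)`. [folklore] -/
theorem comm_star_right (a b : ℍ) : a * star b - star b * a = -(a * b - b * a) := by
  rw [star_eq_two_re_sub']
  simp only [mul_sub, sub_mul, Quaternion.coe_mul_eq_smul, Quaternion.mul_coe_eq_smul]
  abel

/-! ## §2 Group commutator minus one is algebra commutator times a unit -/

/-- For a unit quaternion `a·ā = 1` and `ā·a = 1`. [folklore] -/
theorem mul_star_self_of_norm {a : ℍ} (ha : ‖a‖ = 1) : a * star a = 1 ∧ star a * a = 1 := by
  have h1 : Quaternion.normSq a = 1 := by rw [Quaternion.normSq_eq_norm_mul_self, ha, mul_one]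
  constructor
  · rw [Quaternion.self_mul_star, h1]; rfl
  · rw [Quaternion.star_mul_self, h1]; rfl

/-- ★★ **Group commutator minus one**: `a·b·ā·b̄ − 1 = (ab − ba)·(ā·b̄)` for unit `a, b`. [cite: CosteEtAl1985] -/
theorem groupComm_sub_one {a b : ℍ} (ha : ‖a‖ = 1) (hb : ‖b‖ = 1) :
    a * b * star a * star b - 1 = (a * b - b * a) * (star a * star b) := by
  have haa := (mul_star_self_of_norm ha).1
  have hbb := (mul_star_self_of_norm hb).1
  have e : (a * b - b * a) * (star a * star b) = a * b * star a * star b - b * (a * star a) * star b := by noncomm_ring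
  rw [e, haa, mul_one, hbb]

/-- The cyclic variant `b·ā·b̄·a − 1 = (ab − ba)·(b̄·a)`. [cite: CosteEtAl1985] -/
theorem groupComm_sub_one_cyc₁ {a b : ℍ} (ha : ‖a‖ = 1) (hb : ‖b‖ = 1) :
    b * star a * star b * a - 1 = (a * b - b * a) * (star b * a) := by
  have ha' : ‖star a‖ = 1 := by rw [norm_star, ha]
  have h := groupComm_sub_one hb ha'
  rw [star_star] at h
  rw [h, comm_star_left]

/-- The cyclic variant `ā·b̄·a·b − 1 = (ab − ba)·(a·b)`. [cite: CosteEtAl1985] -/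
theorem groupComm_sub_one_cyc₂ {a b : ℍ} (ha : ‖a‖ = 1) (hb : ‖b‖ = 1) :
    star a * star b * a * b - 1 = (a * b - b * a) * (a * b) := by
  have ha' : ‖star a‖ = 1 := by rw [norm_star, ha]
  have hb' : ‖star b‖ = 1 := by rw [norm_star, hb]
  have h := groupComm_sub_one ha' hb'
  rw [star_star, star_star] at h
  rw [h, comm_star_star]

/-- The cyclic variant `b̄·a·b·ā − 1 = (ab − ba)·(b·ā)`. [cite: CosteEtAl1985] -/
theorem groupComm_sub_one_cyc₃ {a b : ℍ} (ha : ‖a‖ = 1) (hb : ‖b‖ = 1) :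
    star b * a * b * star a - 1 = (a * b - b * a) * (b * star a) := by
  have hb' : ‖star b‖ = 1 := by rw [norm_star, hb]
  have h := groupComm_sub_one hb' ha
  rw [star_star] at h
  rw [h]
  congr 1
  rw [show star b * a - a * star b = -(a * star b - star b * a) by abel, comm_star_right, neg_neg]

/-! ## §3 One-insertion first variations -/

/-- `|Re(τ·m·v)| ≤ ‖τ‖·‖m‖` for a unit `v`. [folklore] -/
theorem abs_re_mul_mul_le (τ m v : ℍ) (hv : ‖v‖ = 1) : |(τ * (m * v)).re| ≤ ‖τ‖ * ‖m‖ := by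
  have h := Literature.MathematicalPhysics.QuantumLattice.abs_re_le_norm (τ * (m * v))
  rw [norm_mul, norm_mul, hv, mul_one] at h
  exact h

/-- ★★ **The one-insertion first variation is linear in the algebra commutator, with a bound**: for unit `a, b` and any `τ`, each of the four words
`W ∈ {abāb̄, bāb̄a, āb̄ab, b̄abā}` (each `= 1 + [a,b]·unit`) satisfies `|Re(τ·(W − 1))| ≤ ‖τ‖·‖ab − ba‖`.  (In the lattice: `−2Re(τ·(W−1))` is the first variation of the deficit `2 − 2Re W` of
a doubly-wrap plaquette ∕ wrap-link seam bond under one insertion, and `‖ab − ba‖ = 2|Im a × Im b|`, ✓`normSq_comm_eq`.) [cite: CosteEtAl1985] -/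
theorem abs_re_insertion_le {a b : ℍ} (ha : ‖a‖ = 1) (hb : ‖b‖ = 1) (τ : ℍ) :
    |(τ * (a * b * star a * star b - 1)).re| ≤ ‖τ‖ * ‖a * b - b * a‖ ∧
    |(τ * (b * star a * star b * a - 1)).re| ≤ ‖τ‖ * ‖a * b - b * a‖ ∧
    |(τ * (star a * star b * a * b - 1)).re| ≤ ‖τ‖ * ‖a * b - b * a‖ ∧
    |(τ * (star b * a * b * star a - 1)).re| ≤ ‖τ‖ * ‖a * b - b * a‖ := by
  have ha' : ‖star a‖ = 1 := by rw [norm_star, ha]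
  have hb' : ‖star b‖ = 1 := by rw [norm_star, hb]
  refine ⟨?_, ?_, ?_, ?_⟩
  · rw [groupComm_sub_one ha hb]
    exact abs_re_mul_mul_le τ _ _ (by rw [norm_mul, ha', hb', mul_one])
  · rw [groupComm_sub_one_cyc₁ ha hb]
    exact abs_re_mul_mul_le τ _ _ (by rw [norm_mul, hb', ha, mul_one])
  · rw [groupComm_sub_one_cyc₂ ha hb]
    exact abs_re_mul_mul_le τ _ _ (by rw [norm_mul, ha, hb, mul_one])
  · rw [groupComm_sub_one_cyc₃ ha hb]
    exact abs_re_mul_mul_le τ _ _ (by rw [norm_mul, hb, ha', mul_one])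

/-- ★ The commutator norm is the Lagrange form of the imaginary parts: `‖ab − ba‖ ≤ 2·‖a‖·‖b‖` and, for the bound above in block letters,
`‖ab − ba‖² = 4(|Im a|²|Im b|² − (Im a·Im b)²)` (✓`normSq_comm_eq`, restated for convenience of citation). [folklore] -/
theorem norm_comm_le (a b : ℍ) : ‖a * b - b * a‖ ≤ 2 * ‖a‖ * ‖b‖ := by
  calc ‖a * b - b * a‖ ≤ ‖a * b‖ + ‖b * a‖ := norm_sub_le _ _
    _ = 2 * ‖a‖ * ‖b‖ := by rw [norm_mul, norm_mul]; ring

end Summit.QuantumFields.YangMills.Theorems.VirialFluxGap.CommutatorInsertion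

end
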